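import Summits.BirchSwinnertonDyer.Rank1Residual.Additive.GordDescentField
import Summits.BirchSwinnertonDyer.Rank1Residual.Additive.GordDescentFreeFieldThree
import HarnessLib

/-!
# X3♯(G-ord) / X4♯(G-ord), defect 2: ONE SENTENCE — every pair has a quadratic field `K`, ramified at `p`, over which `E` is GOOD ORDINARY above `p` and `BSD(E,p) ⟺` the `p`-part of BSD for `E/K`

HONEST FRAMING (cell `b2b-bsdres`, run/shared/lean/b2b/bsd-rank1-residual/, verbatim in every
file): the goal of the cell is to DELETE the COMBINATION-SHAPED residual classes of the
Birch–Swinnerton-Dyer formula for ALL analytic-rank `≤ 1` elliptic curves over `ℚ` — "full BSD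
formula for every rank `≤ 1` curve in class `C`" assembled STRICTLY from published theorems — so
that the rank-`≤ 1` remainder becomes exactly the CONSTRUCTION-SHAPED classes, which are TYPED
(missing-input `Prop`s), NOT attempted. This is not "finishing BSD". Sub-cell `additive-p2`
(CLASS-OWNERS row "X3/X4 additive — pot. good ordinary / X3♯(G-ord)"), generation 6: research
route; no claim beyond the stated classes; theorems only, no definition, no new named fact;
X3♯(G-ord)/X4♯(G-ord) stay CONSTRUCTION-SHAPED.

WHAT THIS FILE DOES. It joins the two gen-6 threads — the reduction type of the over-`K` datum
(`GordDescentField.lean`) and the free descent field (`GordDescentFreeField*.lean`) — into the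
sub-cell's one-sentence statement for the defect-2 (Kodaira `I₀*`) cell at `p ≥ 5`:

* `good_and_unitRoot_baseChange_of_goodOrd_model_twist_discr` — for ANY quadratic field `K` and a
  globally minimal model `Wd ≅ E^{(d_K)}` that is good ordinary at `p`: `E_K` is GOOD with the
  UNIT-ROOT condition at every `w ∋ p` (`√d_K ∈ K`, tree `Quadratic.exists_sq_eq_discr`;
  `good_and_unitRoot_baseChange_of_goodOrd_twist_of_sq_eq`);
* **`ClassX4Gord.exists_quadraticField_goodOrd_bsdp_iff`** — `(E,p) ∈ X4♯(G-ord)`, `e_E(p) = 2`,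
  `p ≥ 5`, `ρ̄_{E,p}` onto, `r_an(E) ≤ 1` (binders: GZK, modularity, Milne 1972 any-model,
  BCS 2025 Cor. 1.3.1, Hoffstein–Luo 1997): **there is a quadratic field `K` with `p ∣ d_K` such that
  `E_K` has GOOD ORDINARY reduction at every prime `w ∋ p`, `e(w|p) = 2`, and
  `BSDp W p ↔ MissingPPartOverCAt (W.baseChange K) p`**;
* **`ClassX3Gord.exists_quadraticField_goodOrd_bsdp_iff`** — the same for `(E,p) ∈ X3♯(G-ord)`,
  `e_E(p) = 2`, `p ≥ 5`, `r_an(E) ≤ 1` (binders: Castella–Grossi–Skinner 2025 Thm. D chain, GZK,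
  modularity, Milne, Hoffstein–Luo).

So, for these pairs, Miller's `BSD(E,p)` over `ℚ` IS — both directions — the `p`-part of the
Birch–Swinnerton-Dyer formula of `E` over an explicit kind of quadratic field: ramified at `p`, with
`E` good ordinary at the ramified prime. That statement is reached by no published theorem
(Wan 2015 §1.1 / Burungale–Castella–Skinner 2025 §2.1: `p` unramified; Bertolini–Darmon–Prasanna /
Jetchev–Skinner–Wan / Bertolini–Longo–Venerucci 2026: `p ∤ d_K`; W. Zhang 2014: `p ∤ D_K N`);
labels, census, located gap UNCHANGED (HOME/b2b-bsdres-additive-p2/AUDIT-X34-GORD.md).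

References: D. Delbourgo, Compositio Math. 113 (1998) §1.5; J. S. Milne, Invent. Math. 17 (1972);
J. Hoffstein, W. Luo, Math. Res. Lett. 4 (1997); A. Burungale, F. Castella, C. Skinner, IMRN 2025
Cor. 1.3.1; F. Castella, G. Grossi, C. Skinner (2025) Thm. D; D. A. Marcus, *Number Fields*, Ch. 2
Thm. 1.
-/

noncomputable section

open scoped Classical NumberField

open WeierstrassCurve IsDedekindDomain NumberField Literature.NumberTheory.EllipticCurves
  Literature.NumberTheory.EllipticCurves.Rank1Residual
  Literature.NumberTheory.EllipticCurves.Rank1Residual.Typed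
  Literature.NumberTheory.EllipticCurves.ModularForms
  Literature.NumberTheory.EllipticCurves.Wuthrich2014
  Summit.BirchSwinnertonDyer.Rank1Residual.AdditivePotMult

namespace Summit.BirchSwinnertonDyer.Rank1Residual.Additive

variable (W : WeierstrassCurve ℚ) [W.IsElliptic] [W.IsGloballyMinimal] (p : ℕ) [hp : Fact p.Prime]
  (K : Type) [Field K] [NumberField K]

omit [W.IsGloballyMinimal] in
/-- **`E_K` is good ordinary above `p` whenever `E^{(d_K)}` is good ordinary at `p`** (ANY quadratic
field `K`, any prime `p`): `√d_K ∈ K` (tree `Quadratic.exists_sq_eq_discr`, Marcus Ch. 2 Thm. 1) and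
`good_and_unitRoot_baseChange_of_goodOrd_twist_of_sq_eq`. -/
theorem good_and_unitRoot_baseChange_of_goodOrd_model_twist_discr (h2 : Module.finrank ℚ K = 2)
    (Wd : WeierstrassCurve ℚ) [Wd.IsElliptic] [Wd.IsGloballyMinimal]
    (hWd : ∃ C : VariableChange ℚ, C • W.quadraticTwist (NumberField.discr K : ℚ) = Wd)
    (hord : GoodOrd Wd p) (w : HeightOneSpectrum (𝓞 K)) (hw : (p : 𝓞 K) ∈ w.asIdeal) :
    (W.baseChange K).HasGoodReductionAt w ∧ (W.baseChange K).HasUnitRootAt w := by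
  obtain ⟨-, -, δ, -, hδ⟩ := Literature.NumberTheory.QuadraticFields.Quadratic.exists_sq_eq_discr h2
  have h := congrArg (algebraMap (𝓞 K) K) hδ
  rw [map_pow, map_intCast] at h
  have hk : ((δ : K)) ^ 2 = algebraMap ℚ K (NumberField.discr K : ℚ) := by
    rw [map_intCast]; exact h
  have hk0 : (δ : K) ≠ 0 := by
    intro h0
    have h' : ((δ : K)) ^ 2 = (NumberField.discr K : K) := h
    rw [h0, zero_pow two_ne_zero] at h'
    have hd0 : (NumberField.discr K : K) ≠ 0 := by exact_mod_cast NumberField.discr_ne_zero K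
    exact hd0 h'.symm
  obtain ⟨C, hC⟩ := hWd
  exact good_and_unitRoot_baseChange_of_goodOrd_twist_of_sq_eq W p K w hk hk0 Wd C hC hord hw

/-- **X4♯(G-ord) ∩ `I₀*`, `p ≥ 5`, `ρ̄` onto, `r_an(E) ≤ 1 — the one-sentence form.** There is a
quadratic field `K` with `p ∣ d_K` over which `E` has GOOD ORDINARY reduction at every prime
`w ∋ p` (with `e(w|p) = 2`) and for which `BSDp W p ↔ MissingPPartOverCAt (W.baseChange K) p`.
(`ClassX4Gord.exists_quadraticField_bsdp_iff`'s field, produced by the Hoffstein–Luo supply, with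
the reduction type from `good_and_unitRoot_baseChange_of_goodOrd_model_twist_discr` and the
ramification from `ramificationIdx_eq_two_of_dvd_discr`.) [cite: HoffsteinLuo1997, Theorem (§1, pp. 435–436)]
[cite: BurungaleCastellaSkinner2025, Cor. 1.3.1 (p. 4)] -/
theorem ClassX4Gord.exists_quadraticField_goodOrd_bsdp_iff
    (hGZK : rank_eq_analyticRank_of_analyticRank_le_one) (hmod : hasEntireLFunction_rat)
    (hMilneC : Milne1972.bsdQuotient_baseChange_quadratic_anyModel)
    (hBCS : BurungaleCastellaSkinner2025.cor131_padicValRat_bsd_rank_le_one)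
    (hHL : HoffsteinLuo1997_exists_twist_L_one_ne_zero)
    (hp5 : 5 ≤ p) (hX : ClassX4Gord W p) (he : semistabilityIndex W p = 2) (hsurj : Surj W p)
    (hr : W.analyticRank ≤ 1) :
    ∃ (K : Type) (_ : Field K) (_ : NumberField K), Module.finrank ℚ K = 2 ∧
      (p : ℤ) ∣ NumberField.discr K ∧
      (∀ w : HeightOneSpectrum (𝓞 K), (p : 𝓞 K) ∈ w.asIdeal →
        (W.baseChange K).HasGoodReductionAt w ∧ (W.baseChange K).HasUnitRootAt w ∧
          (Ideal.span {(p : ℤ)}).ramificationIdx' w.asIdeal = 2) ∧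
      (BSDp W p ↔ MissingPPartOverCAt (W.baseChange K) p) := by
  have hp2 : p ≠ 2 := by omega
  obtain ⟨d', Wd, iWd, iWdm, hsq, hd8, hpd, ⟨C, hC⟩, hord, hr0⟩ :=
    exists_goodOrd_rankZero_twist_of_typeGOrd W p hHL hp5 hX.typeGOrd he
  obtain ⟨K, iF, iN, h2, hdK⟩ := exists_quadraticField_discr_pStar_mul p hp2 hsq hd8 hpd
  have hdKQ : (NumberField.discr K : ℚ) = (-1 : ℚ) ^ (p / 2) * p * d' := by
    rw [hdK]; push_cast; ring
  have hpdK : (p : ℤ) ∣ NumberField.discr K := by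
    rw [hdK]; exact ⟨(-1 : ℤ) ^ (p / 2) * d', by ring⟩
  have hWdK : ∃ C : VariableChange ℚ, C • W.quadraticTwist (NumberField.discr K : ℚ) = Wd := by
    rw [hdKQ]; exact ⟨C, hC⟩
  have hrd : Wd.analyticRank ≤ 1 := by rw [hr0]; exact zero_le_one
  refine ⟨K, iF, iN, h2, hpdK, fun w hw => ?_, bsdp_iff_overC_of_classX4_of_surj_of_goodOrd_twist W p
    Wd hGZK hmod hMilneC hBCS hp5 hX.classX4 hsurj hr K h2 hWdK hord hrd⟩
  obtain ⟨hg, hu⟩ :=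
    good_and_unitRoot_baseChange_of_goodOrd_model_twist_discr W p K h2 Wd hWdK hord w hw
  exact ⟨hg, hu, ramificationIdx_eq_two_of_dvd_discr p K w h2 hpdK hw⟩

/-- **X3♯(G-ord) ∩ `I₀*`, `p ≥ 5`, `r_an(E) ≤ 1 — the one-sentence form.** There is a quadratic
field `K` with `p ∣ d_K` over which `E` has GOOD ORDINARY reduction at every prime `w ∋ p`
(`e(w|p) = 2`) and for which `BSDp W p ↔ MissingPPartOverCAt (W.baseChange K) p` (the field of
`ClassX3Gord.exists_quadraticField_bsdp_iff`: a non-anomalous rank-0 good ordinary twist, row C6).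
[cite: HoffsteinLuo1997, Theorem (§1, pp. 435–436)] [cite: CastellaGrossiSkinner2025, Thm. D (= 'Thm. 4')] -/
theorem ClassX3Gord.exists_quadraticField_goodOrd_bsdp_iff
    (hCGS : CastellaGrossiSkinner2025.thmD_padicValRat_bsd_rank_le_one)
    (hGV : GreenbergVatsal2000.thm13_charIdeal_eq_of_gvPar) (hGr : greenberg_charValue_rankZero)
    (hmod : hasEntireLFunction_rat) (hmodP : nonempty_modularParametrizationData)
    (hGZK : rank_eq_analyticRank_of_analyticRank_le_one)
    (hMilneC : Milne1972.bsdQuotient_baseChange_quadratic_anyModel)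
    (hHL : HoffsteinLuo1997_exists_twist_L_one_ne_zero)
    (hp5 : 5 ≤ p) (hX : ClassX3Gord W p) (he : semistabilityIndex W p = 2)
    (hr : W.analyticRank ≤ 1) :
    ∃ (K : Type) (_ : Field K) (_ : NumberField K), Module.finrank ℚ K = 2 ∧
      (p : ℤ) ∣ NumberField.discr K ∧
      (∀ w : HeightOneSpectrum (𝓞 K), (p : 𝓞 K) ∈ w.asIdeal →
        (W.baseChange K).HasGoodReductionAt w ∧ (W.baseChange K).HasUnitRootAt w ∧
          (Ideal.span {(p : ℤ)}).ramificationIdx' w.asIdeal = 2) ∧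
      (BSDp W p ↔ MissingPPartOverCAt (W.baseChange K) p) := by
  have hp2 : p ≠ 2 := by omega
  obtain ⟨d', Wd, iWd, iWdm, hsq, hd8, hpd, ⟨C, hC⟩, hord, hr0, hna⟩ :=
    exists_goodOrd_rankZero_nonAnom_twist_of_typeGOrd W p hHL hp5 hX.typeGOrd he
  obtain ⟨K, iF, iN, h2, hdK⟩ := exists_quadraticField_discr_pStar_mul p hp2 hsq hd8 hpd
  have hdKQ : (NumberField.discr K : ℚ) = (-1 : ℚ) ^ (p / 2) * p * d' := by
    rw [hdK]; push_cast; ring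
  have hpdK : (p : ℤ) ∣ NumberField.discr K := by
    rw [hdK]; exact ⟨(-1 : ℤ) ^ (p / 2) * d', by ring⟩
  have hWdK : ∃ C : VariableChange ℚ, C • W.quadraticTwist (NumberField.discr K : ℚ) = Wd := by
    rw [hdKQ]; exact ⟨C, hC⟩
  have hrd : Wd.analyticRank ≤ 1 := by rw [hr0]; exact zero_le_one
  refine ⟨K, iF, iN, h2, hpdK, fun w hw => ?_, bsdp_iff_overC_of_classX3_of_nonAnom_twist W p Wd
    hCGS hGV hGr hmod hmodP hGZK hMilneC (by omega) hX.classX3 hr K h2 hWdK hord hrd hna⟩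
  obtain ⟨hg, hu⟩ :=
    good_and_unitRoot_baseChange_of_goodOrd_model_twist_discr W p K h2 Wd hWdK hord w hw
  exact ⟨hg, hu, ramificationIdx_eq_two_of_dvd_discr p K w h2 hpdK hw⟩

end Summit.BirchSwinnertonDyer.Rank1Residual.Additive

end
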